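import Summits.CriticalPhenomena.Ising3DConformalLimit.Theses.ArmHyperscaling
import Summits.CriticalPhenomena.Ising3DConformalLimit.Theorems.AnomalousForcesInteractionEtaPositiveOfOneArm
import Summits.CriticalPhenomena.Ising3DConformalLimit.Theorems.HyperoctahedralRPLimitRotationInvariantMarkovDefs
import Literature.Probability.LatticeModels.HighDimPointwiseTriviality
import Literature.Probability.LatticeModels.CriticalTwoPointLower
import Literature.Probability.LatticeModels.MeanFieldBoundGHS
import Literature.Probability.LatticeModels.ImprovedTreeDiagramBoundProofs
import HarnessLib

/-!
# Disproof of `OneArmHyperscaling` (stmt-CriticalPhenomena-15591) — findings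

Crux (verbatim shape): `∃ K ≥ 1, ∃ C, ∀ n ≥ 1, (m⁺_{Kn})² ≤ C · ⟨σ₀σ_{2ne₀}⟩_{β_c(3)}` with
`m⁺_L := ⟨σ₀⟩⁺_{Λ_L;β_c(3),0}` (`boxMag L` below) and `⟨σ₀σ_{2ne₀}⟩_{β_c(3)}` (`axisTwoPoint n`).

**Verdict of this cycle: NO KILL.**  The statement is faithful (centre of a centred box, `h = 0`, plus
b.c., infinite-volume plus state on the right), every quantity in it is finite and strictly positive
(`boxMag_pos`, `axisTwoPoint_pos`), and it asserts exactly the saturation of Tasaki's inequality on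
`ℤ³` (one-arm exponent `= Δσ`), which finite-size scaling predicts and no rigorous or numerical source
contradicts.  A refutation needs `(m⁺_{Kn})²/⟨σ₀σ_{2ne₀}⟩ → ∞` for EVERY `K`, i.e. a wired FK-Ising
one-arm exponent `< Δσ` on `ℤ³`; the only inequality technology in the tree (and in print) pins that
ratio inside a window of polynomial width `n³` (`ratio_window`), no better.

What IS proved here (sorry-free; sections A–C), for the provers:

* **A. Load-bearing analysis.**
  - `oneArmHyperscaling_iff_at` : the crux is `∃ K ≥ 1, OneArmHyperscalingAt K` (its `K`-slices).
  - `oneArmHyperscaling_false_without_hK` : the slice `K = 0` is FALSE (a fixed single-site box against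
    a two-point function that tends to `0` by the infrared bound) — the hypothesis `1 ≤ K` is load-bearing,
    any proof must use that the box grows with `n`.
  - `OneArmHyperscalingAt.mono` : the slices are MONOTONE in `K` (plus correlations decrease with the
    volume), so the crux is its own `K → ∞` germ: the prover may take `K` as large as convenient, and the
    strongest slice `K = 1` is the QT open core (`oneArmHyperscalingAt_one_iff_oneArmBound`,
    `stub_oneArmBound` of crux 1980).
  - `oneArmHyperscalingAt_iff_all_n` : the restriction `1 ≤ n` is NOT load-bearing (`n = 0` costs `C ↦ max C 1`).
  - `oneArmHyperscalingFreeBC_trivial` : with FREE boundary condition the left side vanishes identically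
    (spin flip), so the plus boundary condition carries all the content (recorded, obvious).
* **B. Tightness / the rigorous window.**
  - `axisTwoPoint_far_le_boxMag_sq` : Tasaki's converse `⟨σ₀σ_{(2Kn+2)e₀}⟩ ≤ (m⁺_{Kn})²` (landed GKS
    decoupling, `twoPointPlus_le_isingCorr_plus_box_sq`), whence `m⁺_L ≥ a/L` (`boxMag_lower`, with the
    Simon–Lieb lower bound `⟨σ₀σ_x⟩ ≥ c‖x‖⁻²`).
  - `ratio_window` : `c₀/(K²n) ≤ (m⁺_{Kn})²/⟨σ₀σ_{2ne₀}⟩ ≤ C₀ n²` for all `K, n ≥ 1` — everything the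
    owned inequalities (GKS, GHS-free, IRB, Simon–Lieb, Tasaki) give; the crux asserts `≤ C`.
* **C. Natural strengthenings refuted.**  The exponent ladder
  `OneArmHyperscalingExp p := ∃ K ≥ 1, ∃ C, ∀ n ≥ 1, (m⁺_{Kn})^p ≤ C ⟨σ₀σ_{2ne₀}⟩` (real `p`):
  - `oneArmHyperscaling_iff_exp_two` : the crux is `p = 2`;
  - `OneArmHyperscalingExp.mono` : monotone in `p` (larger `p` is weaker, `0 < m⁺ ≤ 1`);
  - `not_oneArmHyperscalingExp_of_lt_one` : **FALSE for every `p < 1`** (`m⁺_{Kn} ≥ a/(Kn)` against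
    `⟨σ₀σ_{2ne₀}⟩ ≤ C₁/n`);
  - scaling theory: true iff `p ≥ 2` (`(m⁺)^p/⟨σσ⟩ ≍ n^{(2-p)Δσ}`); rigorous status: OPEN for every
    `p ≥ 1` — even `p = 10⁶` is open, because (`exists_oneArmHyperscalingExp_iff_polyDecay`, proved)
    `(∃ p > 0, OneArmHyperscalingExp p)` is EQUIVALENT to SOME polynomial decay `m⁺_L ≤ C L^{-a}`, `a > 0`,
    which is van Engelenburg–Garban–Panis–Severo's open problem (arXiv:2510.23423, after Thm 1.12;
    arXiv:2406.15243 §1.4.1 Open Problem 1).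
    So the crux sits at the SHARP end (`p = 2`) of a family whose WEAK end is already open: this is
    why it resists, and why no cheap counterexample can exist (any counterexample to `p = 2` that is not
    one to `p = 1` must resolve the one-arm exponent to precision `Δσ` vs. `2Δσ - 1`).

* **D. The refuter's goal and the dimension barrier.**
  - `not_oneArmHyperscaling_iff` : `¬ crux ↔ ∀ K ≥ 1, ∀ C, ∃ n ≥ 1, C < (m⁺_{Kn})²/⟨σ₀σ_{2ne₀}⟩`
    (what a disproof must deliver: unbounded ratio at EVERY `K`).
  - `oneArmHyperscaling_highDim_false_of_meanFieldLowerBound` : modulo van Engelenburg–Garban–Panis–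
    Severo Thm 1.1 (`m⁺_n ≥ c/n`, all `d ≥ 2`; printed, not in the tree) the verbatim analogue of the crux
    is FALSE in every `d ≥ 5` (IRB `⟨σσ⟩ ≤ C₁ n^{-(d-2)}`): the barrier `IsingTrivialityFromDimensionFour`
    for this crux, as a kernel-checked implication.

Numerical status (why a kill would contradict data, not only theory): Hasenbusch, arXiv:1005.4749
(PRB 82, 104425), §6.2 — improved Blume–Capel model (3D Ising class), films with `++` boundaries at bulk
`β_c`: mid-film magnetisation `m|_{z=0} = C_m (L₀+L_s)^{-β/ν}` with `β/ν = (1+η)/2 = Δσ` FIXED fits with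
`χ²/dof = 0.34` (`L₀ ≥ 24`, `C_m = 1.34250(10)`, `L_s = 1.937(4)`), i.e. the one-point function under
symmetry-breaking boundaries scales with exponent `Δσ` to four digits; the cube only changes the
amplitude in FSS.  In `d = 2` the analogue of the crux is a THEOREM (RSW: `φ[0 ↔ 2ne₁] ≍ φ[0 ↔ ∂Λ_n]²`,
arXiv:2510.23423 p. 6), in `d ≥ 5` it is FALSE (section D), on `ℤ³` it is open both ways.

Attacks that found nothing (details in the session NOTES): junk values (`limUnder`) — irrelevant, all
limits exist by `hasBoxLimit_isingCorr_plus_holds`; vacuity — none (∃∃∀ over inhabited numerics);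
degenerate `K = 0` / `n = 0` — above; `d ≥ 5` analogue — FALSE in print (arXiv:2510.23423 Thms 1.1–1.2,
`m⁺_n ≍ 1/n` for `d > 4`, against `⟨σσ⟩ ≲ n^{2-d}`); the `d`-uniform lower bound `m⁺_n ≥ c/n` is not in
the tree (only `m⁺_n ≥ c n^{-(d-1)/2}` via Tasaki + Simon–Lieb, which does not break `d ≥ 5`), so the
dimension barrier is mechanised MODULO that printed theorem (section D), not unconditionally.
-/

noncomputable section

namespace Summit.CriticalPhenomena.Ising3DConformalLimit.Cruxes.OneArmHyperscaling.Disproof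

open Literature.Probability.LatticeModels Finset Filter Topology
open Summit.CriticalPhenomena.Ising3DConformalLimit.Theses.ArmHyperscaling (OneArmHyperscaling)

/-! ### Vocabulary -/

/-- `m⁺_L := ⟨σ₀⟩⁺_{Λ_L;β_c(3),0}`, the crux's left-hand base (= `plusBoxMag` of the QT line). [folklore] -/
def boxMag (L : ℕ) : ℝ :=
  isingCorr (zdGraph 3) (box 3 L) (criticalBeta 3) 0 BoundaryCondition.plus ({0} : Finset (Site 3))

/-- `⟨σ₀σ_{2ne₀}⟩_{β_c(3)}`, the crux's right-hand side. [folklore] -/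
def axisTwoPoint (n : ℕ) : ℝ := criticalTwoPoint 3 (Pi.single 0 (2 * (n : ℤ)))

/-- The `K`-slice of the crux: `∃ C, ∀ n ≥ 1, (m⁺_{Kn})² ≤ C ⟨σ₀σ_{2ne₀}⟩`. [folklore] -/
def OneArmHyperscalingAt (K : ℕ) : Prop :=
  ∃ C : ℝ, ∀ n : ℕ, 1 ≤ n → boxMag (K * n) ^ 2 ≤ C * axisTwoPoint n

/-- The crux is the union of its slices `K ≥ 1` (definitional). [folklore] -/
theorem oneArmHyperscaling_iff_at : OneArmHyperscaling ↔ ∃ K : ℕ, 1 ≤ K ∧ OneArmHyperscalingAt K :=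
  Iff.rfl

/-! ### Basic facts about the two quantities -/

private theorem supNorm_single_nat (m : ℕ) : Site.supNorm (Pi.single 0 (m : ℤ) : Site 3) = m := by
  apply le_antisymm
  · rw [Site.supNorm_le_iff]
    intro j
    by_cases hj : j = 0
    · subst hj; simp
    · rw [Pi.single_eq_of_ne hj]; simp
  · have := Site.natAbs_le_supNorm (Pi.single 0 (m : ℤ) : Site 3) 0
    simpa using this

private theorem single_nat_ne_zero {m : ℕ} (hm : 1 ≤ m) : (Pi.single 0 (m : ℤ) : Site 3) ≠ 0 := by
  intro h
  have := congrFun h 0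
  simp at this
  omega

/-- `0 ≤ m⁺_L` (GKS I). [folklore] -/
theorem boxMag_nonneg (L : ℕ) : 0 ≤ boxMag L :=
  GKSInequalities.gks_one_holds (zdGraph 3) (criticalBeta_nonneg 3) le_rfl (Or.inr rfl)
    (Finset.singleton_subset_iff.2 (zero_mem_box 3 L))

/-- `m⁺_L ≤ 1`. [folklore] -/
theorem boxMag_le_one (L : ℕ) : boxMag L ≤ 1 :=
  (abs_le.1 (abs_isingCorr_le_one (zdGraph 3) (box 3 L) (criticalBeta 3) 0 .plus {0})).2

/-- `L ↦ m⁺_L` is non-increasing (plus correlations decrease with the volume, GKS). [folklore] -/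
theorem boxMag_antitone {L L' : ℕ} (h : L ≤ L') : boxMag L' ≤ boxMag L :=
  isingCorr_plus_le_of_subset (zdGraph 3) (criticalBeta_nonneg 3) le_rfl
    (Finset.singleton_subset_iff.2 (zero_mem_box 3 L)) (box_mono 3 h)

/-- `⟨σ₀σ₀⟩ = 1`: the right-hand side at `n = 0`. [folklore] -/
theorem axisTwoPoint_zero : axisTwoPoint 0 = 1 := by
  simp [axisTwoPoint, criticalTwoPoint_zero']

/-- Simon–Lieb lower bound along the axis: `c/m² ≤ ⟨σ₀σ_{me₀}⟩_{β_c(3)}` for `m ≥ 1`. [folklore] -/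
theorem axis_lower : ∃ c : ℝ, 0 < c ∧ ∀ m : ℕ, 1 ≤ m →
    c / (m : ℝ) ^ 2 ≤ criticalTwoPoint 3 (Pi.single 0 (m : ℤ)) := by
  obtain ⟨c, C, hc, h⟩ := criticalTwoPoint_bounds_holds (d := 3) le_rfl
  refine ⟨c, hc, fun m hm => ?_⟩
  have h1 := (h _ (single_nat_ne_zero hm)).1
  rw [Site.norm_eq_supNorm, supNorm_single_nat] at h1
  have hm0 : (0 : ℝ) < m := by exact_mod_cast hm
  have : (m : ℝ) ^ (-((3 : ℕ) - 1 : ℝ)) = ((m : ℝ) ^ 2)⁻¹ := by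
    rw [Real.rpow_neg hm0.le, show ((3 : ℕ) - 1 : ℝ) = (2 : ℕ) by norm_num, Real.rpow_natCast]
  rw [this, ← div_eq_mul_inv] at h1
  exact h1

/-- Infrared upper bound along the axis: `⟨σ₀σ_{me₀}⟩_{β_c(3)} ≤ C/m` for `m ≥ 1`. [folklore] -/
theorem axis_upper : ∃ C : ℝ, 0 < C ∧ ∀ m : ℕ, 1 ≤ m →
    criticalTwoPoint 3 (Pi.single 0 (m : ℤ)) ≤ C / m := by
  obtain ⟨C, hC, h⟩ := exists_criticalTwoPoint_le_inv_pow (d := 3) le_rfl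
  refine ⟨C + 1, by linarith, fun m hm => ?_⟩
  have h1 := h _ (single_nat_ne_zero hm)
  rw [supNorm_single_nat] at h1
  have hm0 : (0 : ℝ) < m := by exact_mod_cast hm
  calc criticalTwoPoint 3 (Pi.single 0 (m : ℤ)) ≤ C * ((m : ℝ) ^ (3 - 2))⁻¹ := h1
    _ = C / m := by norm_num [div_eq_mul_inv]
    _ ≤ (C + 1) / m := by gcongr; linarith

/-- `⟨σ₀σ_{2ne₀}⟩ ≤ C₁/n` for `n ≥ 1`. [folklore] -/
theorem axisTwoPoint_le : ∃ C₁ : ℝ, 0 < C₁ ∧ ∀ n : ℕ, 1 ≤ n → axisTwoPoint n ≤ C₁ / n := by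
  obtain ⟨C, hC, h⟩ := axis_upper
  refine ⟨C, hC, fun n hn => ?_⟩
  have hn0 : (0 : ℝ) < n := by exact_mod_cast hn
  have h1 := h (2 * n) (by omega)
  have : (Pi.single 0 (((2 * n : ℕ) : ℤ)) : Site 3) = Pi.single 0 (2 * (n : ℤ)) := by push_cast; rfl
  rw [this] at h1
  calc axisTwoPoint n ≤ C / ((2 * n : ℕ) : ℝ) := h1
    _ ≤ C / n := by
      apply div_le_div_of_nonneg_left hC.le hn0
      push_cast; linarith

/-- `c/(4n²) ≤ ⟨σ₀σ_{2ne₀}⟩` for `n ≥ 1`. [folklore] -/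
theorem le_axisTwoPoint : ∃ c : ℝ, 0 < c ∧ ∀ n : ℕ, 1 ≤ n → c / (n : ℝ) ^ 2 ≤ axisTwoPoint n := by
  obtain ⟨c, hc, h⟩ := axis_lower
  refine ⟨c / 4, by positivity, fun n hn => ?_⟩
  have h1 := h (2 * n) (by omega)
  have : (Pi.single 0 (((2 * n : ℕ) : ℤ)) : Site 3) = Pi.single 0 (2 * (n : ℤ)) := by push_cast; rfl
  rw [this] at h1
  calc c / 4 / (n : ℝ) ^ 2 = c / (((2 * n : ℕ) : ℝ)) ^ 2 := by push_cast; ring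
    _ ≤ axisTwoPoint n := h1

/-- `0 < ⟨σ₀σ_{2ne₀}⟩` for every `n`. [folklore] -/
theorem axisTwoPoint_pos (n : ℕ) : 0 < axisTwoPoint n := by
  rcases Nat.eq_zero_or_pos n with rfl | hn
  · rw [axisTwoPoint_zero]; exact one_pos
  · obtain ⟨c, hc, h⟩ := le_axisTwoPoint
    have hn0 : (0 : ℝ) < n := by exact_mod_cast hn
    exact lt_of_lt_of_le (by positivity) (h n hn)

/-! ### B. Tightness: Tasaki's converse and the rigorous window -/

/-- **Tasaki's converse at the crux's scales**: `⟨σ₀σ_{(2L+2)e₀}⟩_{β_c} ≤ (m⁺_L)²` (GKS decoupling of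
the two boxes `Λ_L`, `(2L+2)e₀ + Λ_L`, landed as `twoPointPlus_le_isingCorr_plus_box_sq`). [folklore] -/
theorem axisTwoPoint_far_le_boxMag_sq (L : ℕ) :
    criticalTwoPoint 3 (Pi.single 0 ((2 * L + 2 : ℕ) : ℤ)) ≤ boxMag L ^ 2 :=
  AnomalousForcesInteractionEtaPositive.twoPointPlus_le_isingCorr_plus_box_sq (d := 3)
    (criticalBeta_nonneg 3) (by rw [supNorm_single_nat])

/-- `0 < m⁺_L` for every `L` (Tasaki + Simon–Lieb; no `tanh` computation needed). [folklore] -/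
theorem boxMag_pos (L : ℕ) : 0 < boxMag L := by
  obtain ⟨c, hc, h⟩ := axis_lower
  have h1 := (h (2 * L + 2) (by omega)).trans (axisTwoPoint_far_le_boxMag_sq L)
  have hpos : 0 < c / ((2 * L + 2 : ℕ) : ℝ) ^ 2 := by positivity
  have h2 : 0 < boxMag L ^ 2 := hpos.trans_le h1
  rcases (boxMag_nonneg L).lt_or_eq with h3 | h3
  · exact h3
  · rw [← h3] at h2; norm_num at h2

/-- **One-arm lower bound** `m⁺_L ≥ a/L` (`L ≥ 1`): the tree's `d = 3` instance of the bound
`m⁺_L ≳ L^{-(d-1)/2}` from Tasaki + Simon–Lieb (weaker than arXiv:2510.23423 Thm 1.1 `m⁺_L ≥ c/L` only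
through the constant here, since `(d-1)/2 = 1` in `d = 3`). [folklore] -/
theorem boxMag_lower : ∃ a : ℝ, 0 < a ∧ a ≤ 1 ∧ ∀ L : ℕ, 1 ≤ L → a / L ≤ boxMag L := by
  obtain ⟨c, hc, h⟩ := axis_lower
  refine ⟨min (Real.sqrt c / 4) 1, by positivity, min_le_right _ _, fun L hL => ?_⟩
  have hL0 : (0 : ℝ) < L := by exact_mod_cast hL
  have hL1 : (1 : ℝ) ≤ L := by exact_mod_cast hL
  have h1 := (h (2 * L + 2) (by omega)).trans (axisTwoPoint_far_le_boxMag_sq L)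
  -- take square roots
  have h2 := Real.sqrt_le_sqrt h1
  rw [Real.sqrt_sq (boxMag_nonneg L), Real.sqrt_div' _ (by positivity),
    Real.sqrt_sq (by positivity)] at h2
  calc min (Real.sqrt c / 4) 1 / L ≤ Real.sqrt c / 4 / L := by gcongr; exact min_le_left _ _
    _ ≤ Real.sqrt c / ((2 * L + 2 : ℕ) : ℝ) := by
        rw [div_div]
        apply div_le_div_of_nonneg_left (Real.sqrt_nonneg c) (by positivity)
        push_cast; linarith
    _ ≤ boxMag L := h2

/-- **The rigorous window for the crux's ratio**: for all `K, n ≥ 1`,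
`c₀/(K²n) ≤ (m⁺_{Kn})²/⟨σ₀σ_{2ne₀}⟩ ≤ C₀ n²`.  The crux asserts `≤ C`; a refutation needs `→ ∞`;
the owned inequalities leave a polynomial window of width `n³`. [folklore] -/
theorem ratio_window : ∃ c₀ C₀ : ℝ, 0 < c₀ ∧ 0 < C₀ ∧ ∀ K n : ℕ, 1 ≤ K → 1 ≤ n →
    c₀ / ((K : ℝ) ^ 2 * n) ≤ boxMag (K * n) ^ 2 / axisTwoPoint n ∧
      boxMag (K * n) ^ 2 / axisTwoPoint n ≤ C₀ * (n : ℝ) ^ 2 := by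
  obtain ⟨a, ha, -, hlow⟩ := boxMag_lower
  obtain ⟨C₁, hC₁, hup⟩ := axisTwoPoint_le
  obtain ⟨c, hc, hG⟩ := le_axisTwoPoint
  refine ⟨a ^ 2 / C₁, 1 / c, by positivity, by positivity, fun K n hK hn => ⟨?_, ?_⟩⟩
  · have hK0 : (0 : ℝ) < K := by exact_mod_cast hK
    have hn0 : (0 : ℝ) < n := by exact_mod_cast hn
    have hm := hlow (K * n) (Nat.one_le_iff_ne_zero.2 (Nat.mul_ne_zero (by omega) (by omega)))
    have hGpos := axisTwoPoint_pos n
    rw [div_le_div_iff₀ (by positivity) hGpos]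
    have hm2 : (a / ((K * n : ℕ) : ℝ)) ^ 2 ≤ boxMag (K * n) ^ 2 :=
      pow_le_pow_left₀ (by positivity) hm 2
    have hG1 := hup n hn
    calc a ^ 2 / C₁ * axisTwoPoint n ≤ a ^ 2 / C₁ * (C₁ / n) := by gcongr
      _ = (a / ((K * n : ℕ) : ℝ)) ^ 2 * ((K : ℝ) ^ 2 * n) := by
          push_cast; field_simp
      _ ≤ boxMag (K * n) ^ 2 * ((K : ℝ) ^ 2 * n) := by gcongr
  · have hn0 : (0 : ℝ) < n := by exact_mod_cast hn
    have hGpos := axisTwoPoint_pos n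
    have hG1 := hG n hn
    have hm1 : boxMag (K * n) ^ 2 ≤ 1 := by
      have := boxMag_le_one (K * n)
      have := boxMag_nonneg (K * n)
      nlinarith
    rw [div_le_iff₀ hGpos]
    calc boxMag (K * n) ^ 2 ≤ 1 := hm1
      _ = 1 / c * (c / (n : ℝ) ^ 2) * (n : ℝ) ^ 2 := by field_simp
      _ ≤ 1 / c * axisTwoPoint n * (n : ℝ) ^ 2 := by gcongr
      _ = 1 / c * (n : ℝ) ^ 2 * axisTwoPoint n := by ring

/-! ### A. Load-bearing analysis -/

/-- **`1 ≤ K` is load-bearing: the slice `K = 0` of the crux is false.**  With `K = 0` the box is the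
single site `{0}` for every `n`, `m⁺_0 > 0` is a constant, while `⟨σ₀σ_{2ne₀}⟩ ≤ C₁/n → 0`. [folklore] -/
theorem oneArmHyperscaling_false_without_hK : ¬ OneArmHyperscalingAt 0 := by
  rintro ⟨C, hC⟩
  obtain ⟨C₁, hC₁, hup⟩ := axisTwoPoint_le
  have hm : 0 < boxMag 0 ^ 2 := pow_pos (boxMag_pos 0) 2
  obtain ⟨n, hn⟩ := exists_nat_gt (max C 0 * C₁ / boxMag 0 ^ 2)
  have hn1 : 1 ≤ n + 1 := Nat.succ_le_succ (Nat.zero_le n)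
  have hn0 : (0 : ℝ) < (n + 1 : ℕ) := by positivity
  have key := hC (n + 1) hn1
  rw [zero_mul] at key
  have hG := hup (n + 1) hn1
  have hGpos := axisTwoPoint_pos (n + 1)
  have h1 : boxMag 0 ^ 2 ≤ max C 0 * (C₁ / ((n + 1 : ℕ) : ℝ)) :=
    key.trans ((mul_le_mul_of_nonneg_right (le_max_left _ _) hGpos.le).trans
      (mul_le_mul_of_nonneg_left hG (le_max_right _ _)))
  rw [← mul_div_assoc, le_div_iff₀ hn0] at h1
  rw [div_lt_iff₀ hm] at hn
  push_cast at h1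
  nlinarith

/-- **The slices are monotone in `K`** (`Λ_{Kn} ⊆ Λ_{K'n}` and GKS volume monotonicity): the crux is
equivalent to each of its tails `∃ K ≥ K₀, …`, and its strongest instance is `K = 1`. [folklore] -/
theorem OneArmHyperscalingAt.mono {K K' : ℕ} (hKK' : K ≤ K') :
    OneArmHyperscalingAt K → OneArmHyperscalingAt K' := by
  rintro ⟨C, hC⟩
  refine ⟨C, fun n hn => le_trans ?_ (hC n hn)⟩
  exact pow_le_pow_left₀ (boxMag_nonneg _) (boxMag_antitone (Nat.mul_le_mul_right n hKK')) 2

/-- The crux as a tail statement: `OneArmHyperscaling ↔ ∀ K₀, ∃ K ≥ K₀, OneArmHyperscalingAt K`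
(with `K ≥ 1`). [folklore] -/
theorem oneArmHyperscaling_iff_tail :
    OneArmHyperscaling ↔ ∀ K₀ : ℕ, ∃ K : ℕ, K₀ ≤ K ∧ 1 ≤ K ∧ OneArmHyperscalingAt K := by
  rw [oneArmHyperscaling_iff_at]
  constructor
  · rintro ⟨K, hK, h⟩ K₀
    exact ⟨max K K₀, le_max_right _ _, hK.trans (le_max_left _ _), h.mono (le_max_left _ _)⟩
  · intro h
    obtain ⟨K, -, hK, hOA⟩ := h 1
    exact ⟨K, hK, hOA⟩

/-- The strongest slice suffices: `OneArmHyperscalingAt 1 → OneArmHyperscaling`. [folklore] -/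
theorem oneArmHyperscaling_of_at_one (h : OneArmHyperscalingAt 1) : OneArmHyperscaling :=
  ⟨1, le_rfl, h⟩

/-- The slice `K = 1` is literally the QT line's open core `∃ C, OneArmBound C` (crux 1980,
`Cruxes/LimitRotationInvariant/Lines/quarter_turn_liouville.lean`, `stub_oneArmBound`). [folklore] -/
theorem oneArmHyperscalingAt_one_iff_oneArmBound :
    OneArmHyperscalingAt 1 ↔ ∃ C : ℝ, LimitRotationInvariant.QuarterTurnLiouville.OneArmBound C := by
  simp only [OneArmHyperscalingAt, LimitRotationInvariant.QuarterTurnLiouville.OneArmBound, one_mul,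
    criticalCorr_two, boxMag, axisTwoPoint, LimitRotationInvariant.QuarterTurnLiouville.plusBoxMag]

/-- **`1 ≤ n` is not load-bearing**: the `n = 0` instance only costs `C ↦ max C 1`. [folklore] -/
theorem oneArmHyperscalingAt_iff_all_n (K : ℕ) :
    OneArmHyperscalingAt K ↔ ∃ C : ℝ, ∀ n : ℕ, boxMag (K * n) ^ 2 ≤ C * axisTwoPoint n := by
  constructor
  · rintro ⟨C, hC⟩
    refine ⟨max C 1, fun n => ?_⟩
    rcases Nat.eq_zero_or_pos n with rfl | hn
    · rw [axisTwoPoint_zero, mul_one, mul_zero]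
      have := boxMag_le_one 0
      have := boxMag_nonneg 0
      calc boxMag 0 ^ 2 ≤ 1 := by nlinarith
        _ ≤ max C 1 := le_max_right _ _
    · exact (hC n hn).trans (mul_le_mul_of_nonneg_right (le_max_left _ _) (axisTwoPoint_pos n).le)
  · rintro ⟨C, hC⟩
    exact ⟨C, fun n _ => hC n⟩

/-- With FREE boundary condition the left-hand side vanishes (`⟨σ₀⟩^∅_{Λ;β,0} = 0`, spin flip). [folklore] -/
theorem boxMag_free_eq_zero (L : ℕ) :
    isingCorr (zdGraph 3) (box 3 L) (criticalBeta 3) 0 BoundaryCondition.free ({0} : Finset (Site 3)) = 0 :=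
  isingCorr_free_singleton_zero_field (zdGraph 3) (box 3 L) (criticalBeta 3) (zero_mem_box 3 L)

/-- The crux with the plus boundary condition replaced by the free one. [folklore] -/
def OneArmHyperscalingFreeBC : Prop :=
  ∃ K : ℕ, 1 ≤ K ∧ ∃ C : ℝ, ∀ n : ℕ, 1 ≤ n →
    (isingCorr (zdGraph 3) (box 3 (K * n)) (criticalBeta 3) 0 BoundaryCondition.free
      ({0} : Finset (Site 3))) ^ 2 ≤ C * axisTwoPoint n

/-- … which holds trivially: the plus boundary condition carries all the content. [folklore] -/
theorem oneArmHyperscalingFreeBC_trivial : OneArmHyperscalingFreeBC :=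
  ⟨1, le_rfl, 0, fun n _ => by rw [boxMag_free_eq_zero]; simp⟩

/-! ### C. The exponent ladder: natural strengthenings refuted -/

/-- `OneArmHyperscalingExp p`: the crux with the square replaced by a real power `p`,
`∃ K ≥ 1, ∃ C, ∀ n ≥ 1, (m⁺_{Kn})^p ≤ C ⟨σ₀σ_{2ne₀}⟩`. [folklore] -/
def OneArmHyperscalingExp (p : ℝ) : Prop :=
  ∃ K : ℕ, 1 ≤ K ∧ ∃ C : ℝ, ∀ n : ℕ, 1 ≤ n → boxMag (K * n) ^ p ≤ C * axisTwoPoint n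

/-- The crux is the rung `p = 2`. [folklore] -/
theorem oneArmHyperscaling_iff_exp_two : OneArmHyperscaling ↔ OneArmHyperscalingExp 2 := by
  simp only [oneArmHyperscaling_iff_at, OneArmHyperscalingAt, OneArmHyperscalingExp, Real.rpow_two]

/-- The ladder is monotone: a smaller exponent is a STRONGER statement (`0 < m⁺ ≤ 1`). [folklore] -/
theorem OneArmHyperscalingExp.mono {p q : ℝ} (hpq : p ≤ q) :
    OneArmHyperscalingExp p → OneArmHyperscalingExp q := by
  rintro ⟨K, hK, C, hC⟩
  refine ⟨K, hK, C, fun n hn => le_trans ?_ (hC n hn)⟩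
  exact Real.rpow_le_rpow_of_exponent_ge (boxMag_pos _) (boxMag_le_one _) hpq

/-- **Every rung `p < 1` is false**: `m⁺_{Kn} ≥ a/(Kn)` (Tasaki + Simon–Lieb) against
`⟨σ₀σ_{2ne₀}⟩ ≤ C₁/n` (infrared bound) gives `(a/K)^p n^{1-p} ≤ C C₁`, absurd as `n → ∞`. [folklore] -/
theorem not_oneArmHyperscalingExp_of_lt_one {p : ℝ} (hp : p < 1) : ¬ OneArmHyperscalingExp p := by
  rintro ⟨K, hK, C, hC⟩
  obtain ⟨a, ha, ha1, hlow⟩ := boxMag_lower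
  obtain ⟨C₁, hC₁, hup⟩ := axisTwoPoint_le
  have hK0 : (0 : ℝ) < K := by exact_mod_cast hK
  -- the common consequence: `(m⁺_{Kn})^p * n ≤ B` for all `n ≥ 1`
  set B : ℝ := max C 0 * C₁ with hB
  have hB0 : 0 ≤ B := by positivity
  have step : ∀ n : ℕ, 1 ≤ n → boxMag (K * n) ^ p * n ≤ B := by
    intro n hn
    have hn0 : (0 : ℝ) < n := by exact_mod_cast hn
    have hGpos := axisTwoPoint_pos n
    have h1 : boxMag (K * n) ^ p ≤ max C 0 * (C₁ / n) :=
      (hC n hn).trans ((mul_le_mul_of_nonneg_right (le_max_left _ _) hGpos.le).trans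
        (mul_le_mul_of_nonneg_left (hup n hn) (le_max_right _ _)))
    rw [← mul_div_assoc, le_div_iff₀ hn0] at h1
    exact h1
  -- lower bound for the base: `a/(K n) ≤ m⁺_{Kn}`, and `a/(K n) ≤ 1`
  have base : ∀ n : ℕ, 1 ≤ n → a / K / n ≤ boxMag (K * n) := by
    intro n hn
    have h := hlow (K * n) (Nat.one_le_iff_ne_zero.2 (Nat.mul_ne_zero (by omega) (by omega)))
    rw [div_div]
    exact_mod_cast h
  rcases le_or_gt p 0 with hp0 | hp0
  · -- `p ≤ 0`: `(m⁺)^p ≥ 1`, so `n ≤ B` for all `n`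
    obtain ⟨n, hn⟩ := exists_nat_gt B
    have hn1 : 1 ≤ n + 1 := Nat.succ_le_succ (Nat.zero_le n)
    have h1 : (1 : ℝ) ≤ boxMag (K * (n + 1)) ^ p := by
      rw [← Real.rpow_zero (boxMag (K * (n + 1)))]
      exact Real.rpow_le_rpow_of_exponent_ge (boxMag_pos _) (boxMag_le_one _) hp0
    have h2 := step (n + 1) hn1
    have hn0 : (0 : ℝ) ≤ (n + 1 : ℕ) := by positivity
    have : ((n + 1 : ℕ) : ℝ) ≤ B := le_trans (by nlinarith) h2
    push_cast at this
    linarith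
  · -- `0 < p < 1`: `(a/K)^p n^{1-p} ≤ B`, contradicting `n^{1-p} → ∞`
    have hq : 0 < 1 - p := by linarith
    have hAK : 0 < (a / K) ^ p := Real.rpow_pos_of_pos (by positivity) p
    have hev : ∀ᶠ n : ℕ in atTop, B / (a / K) ^ p < (n : ℝ) ^ (1 - p) :=
      ((tendsto_rpow_atTop hq).comp tendsto_natCast_atTop_atTop).eventually_gt_atTop _
    obtain ⟨n, hn, hn1⟩ := (hev.and (eventually_ge_atTop 1)).exists
    have hn0 : (0 : ℝ) < n := by exact_mod_cast hn1
    have h1 : (a / K / n) ^ p ≤ boxMag (K * n) ^ p :=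
      Real.rpow_le_rpow (by positivity) (base n hn1) hp0.le
    have h2 := step n hn1
    have h3 : (a / K / n) ^ p * n ≤ B := le_trans (by gcongr) h2
    rw [Real.div_rpow (by positivity) hn0.le, div_mul_eq_mul_div, div_le_iff₀ (Real.rpow_pos_of_pos hn0 p)] at h3
    -- `h3 : (a/K)^p * n ≤ B * n^p`; divide by `(a/K)^p n^p`
    have h4 : (n : ℝ) ^ (1 - p) ≤ B / (a / K) ^ p := by
      rw [Real.rpow_sub hn0, Real.rpow_one, le_div_iff₀ hAK, div_mul_eq_mul_div, div_le_iff₀ (Real.rpow_pos_of_pos hn0 p)]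
      linarith
    linarith

/-- In particular the rung `p = 1/2`, i.e. "one-arm `≤ C ·` (two-point)²", is false. [folklore] -/
theorem not_oneArmHyperscalingExp_half : ¬ OneArmHyperscalingExp (1 / 2) :=
  not_oneArmHyperscalingExp_of_lt_one (by norm_num)

/-- **The weak end of the ladder is the open problem "polynomial one-arm decay"**: some rung `p > 0`
holds iff `m⁺_L ≤ C L^{-a}` for some `a > 0` (⇒: `(m⁺_{Kn})^p ≤ C C₁/n` and volume monotonicity;
⇐: `p = 2/a`, `K = 1`, Simon–Lieb `⟨σ₀σ_{2ne₀}⟩ ≥ c/n²`).  A polynomial upper bound on `m⁺_L` with ANY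
exponent is open on `ℤ³` (van Engelenburg–Garban–Panis–Severo, after Thm 1.12), so EVERY rung `p ≥ 1` of
the ladder is open, the crux being the sharp rung `p = 2`. [cite: VanEngelenburgGarbanPanisSevero2025, Theorem 1.1] -/
theorem exists_oneArmHyperscalingExp_iff_polyDecay :
    (∃ p : ℝ, 0 < p ∧ OneArmHyperscalingExp p) ↔
      ∃ a : ℝ, 0 < a ∧ ∃ C : ℝ, ∀ L : ℕ, 1 ≤ L → boxMag L ≤ C * (L : ℝ) ^ (-a) := by
  constructor
  · rintro ⟨p, hp, K, hK, C, hC⟩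
    obtain ⟨C₁, hC₁, hup⟩ := axisTwoPoint_le
    have hK0 : (0 : ℝ) < K := by exact_mod_cast hK
    set B : ℝ := max C 0 * C₁ with hB
    have hB0 : 0 ≤ B := by positivity
    -- along multiples of `K`: `m⁺_{Kn} ≤ (B/n)^{1/p}`
    have hmul : ∀ n : ℕ, 1 ≤ n → boxMag (K * n) ≤ (B / n) ^ (1 / p) := by
      intro n hn
      have hn0 : (0 : ℝ) < n := by exact_mod_cast hn
      have h1 : boxMag (K * n) ^ p ≤ B / n := by
        have := (hC n hn).trans ((mul_le_mul_of_nonneg_right (le_max_left _ _)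
          (axisTwoPoint_pos n).le).trans (mul_le_mul_of_nonneg_left (hup n hn) (le_max_right _ _)))
        rwa [← mul_div_assoc] at this
      have h2 := Real.rpow_le_rpow (Real.rpow_nonneg (boxMag_nonneg _) p) h1 (by positivity : (0:ℝ) ≤ 1 / p)
      rw [one_div] at h2 ⊢
      rwa [Real.rpow_rpow_inv (boxMag_nonneg _) hp.ne'] at h2
    refine ⟨1 / p, by positivity, max (B ^ (1 / p) * ((2 * K : ℕ) : ℝ) ^ (1 / p)) ((K : ℝ) ^ (1 / p)),
      fun L hL => ?_⟩
    have hL0 : (0 : ℝ) < L := by exact_mod_cast hL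
    rcases lt_or_ge L K with hLK | hLK
    · -- small `L < K`: `m⁺_L ≤ 1 ≤ K^{1/p} L^{-1/p}`
      have h1 : (1 : ℝ) ≤ (K : ℝ) ^ (1 / p) * (L : ℝ) ^ (-(1 / p)) := by
        rw [Real.rpow_neg hL0.le, ← div_eq_mul_inv, le_div_iff₀ (Real.rpow_pos_of_pos hL0 _), one_mul]
        exact Real.rpow_le_rpow hL0.le (by exact_mod_cast hLK.le) (by positivity)
      calc boxMag L ≤ 1 := boxMag_le_one L
        _ ≤ (K : ℝ) ^ (1 / p) * (L : ℝ) ^ (-(1 / p)) := h1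
        _ ≤ _ := by gcongr; exact le_max_right _ _
    · -- `L ≥ K`: `n := L / K ≥ 1`, `K n ≤ L < 2 K n`
      set n : ℕ := L / K with hn
      have hn1 : 1 ≤ n := (Nat.one_le_div_iff (by omega)).2 hLK
      have hn0 : (0 : ℝ) < n := by exact_mod_cast hn1
      have hKn : K * n ≤ L := Nat.mul_div_le L K
      have hL2 : L < 2 * K * n := by
        have := Nat.lt_mul_div_succ L (show 0 < K by omega)
        nlinarith
      have h1 : boxMag L ≤ (B / n) ^ (1 / p) := (boxMag_antitone hKn).trans (hmul n hn1)
      have h2 : (B / n) ^ (1 / p) = B ^ (1 / p) * (n : ℝ) ^ (-(1 / p)) := by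
        rw [Real.div_rpow hB0 hn0.le, Real.rpow_neg hn0.le, div_eq_mul_inv]
      -- `n^{-1/p} ≤ (2K)^{1/p} L^{-1/p}` since `L ≤ 2 K n`
      have h3 : (n : ℝ) ^ (-(1 / p)) ≤ ((2 * K : ℕ) : ℝ) ^ (1 / p) * (L : ℝ) ^ (-(1 / p)) := by
        have hL2' : (L : ℝ) ≤ ((2 * K : ℕ) : ℝ) * n := by exact_mod_cast hL2.le
        have h4 : ((L : ℝ) / ((2 * K : ℕ) : ℝ)) ^ (1 / p) ≤ (n : ℝ) ^ (1 / p) := by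
          refine Real.rpow_le_rpow (by positivity) ?_ (by positivity)
          rw [div_le_iff₀ (by positivity)]
          linarith
        rw [Real.div_rpow hL0.le (by positivity)] at h4
        rw [Real.rpow_neg hn0.le, Real.rpow_neg hL0.le, ← div_eq_mul_inv,
          le_div_iff₀ (Real.rpow_pos_of_pos hL0 _)]
        rw [div_le_iff₀ (Real.rpow_pos_of_pos (by positivity) _)] at h4
        rw [inv_mul_le_iff₀ (Real.rpow_pos_of_pos hn0 _)]
        linarith
      calc boxMag L ≤ B ^ (1 / p) * (n : ℝ) ^ (-(1 / p)) := h2 ▸ h1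
        _ ≤ B ^ (1 / p) * (((2 * K : ℕ) : ℝ) ^ (1 / p) * (L : ℝ) ^ (-(1 / p))) := by
            gcongr
        _ = B ^ (1 / p) * ((2 * K : ℕ) : ℝ) ^ (1 / p) * (L : ℝ) ^ (-(1 / p)) := by ring
        _ ≤ _ := by gcongr; exact le_max_left _ _
  · rintro ⟨a, ha, C, hC⟩
    obtain ⟨c, hc, hG⟩ := le_axisTwoPoint
    have hCpos : 0 < C := by
      have h1 := hC 1 le_rfl
      have h2 := boxMag_pos 1
      simp at h1
      linarith
    refine ⟨2 / a, by positivity, 1, le_rfl, C ^ (2 / a) / c, fun n hn => ?_⟩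
    have hn0 : (0 : ℝ) < n := by exact_mod_cast hn
    rw [one_mul]
    have h1 : boxMag n ^ (2 / a) ≤ (C * (n : ℝ) ^ (-a)) ^ (2 / a) :=
      Real.rpow_le_rpow (boxMag_nonneg _) (hC n hn) (by positivity)
    have h2 : (C * (n : ℝ) ^ (-a)) ^ (2 / a) = C ^ (2 / a) * ((n : ℝ) ^ 2)⁻¹ := by
      rw [Real.mul_rpow hCpos.le (Real.rpow_nonneg hn0.le _), ← Real.rpow_mul hn0.le,
        show -a * (2 / a) = -(2 : ℕ) by rw [Nat.cast_ofNat]; field_simp, Real.rpow_neg hn0.le,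
        Real.rpow_natCast]
    have h3 := hG n hn
    calc boxMag n ^ (2 / a) ≤ C ^ (2 / a) * ((n : ℝ) ^ 2)⁻¹ := h2 ▸ h1
      _ = C ^ (2 / a) / c * (c / (n : ℝ) ^ 2) := by field_simp
      _ ≤ C ^ (2 / a) / c * axisTwoPoint n := by gcongr

/-! ### D. What a disproof must show, and the dimension barrier mechanised modulo a printed theorem -/

/-- **The refuter's goal, unfolded**: the slice `K` fails iff the ratio `(m⁺_{Kn})²/⟨σ₀σ_{2ne₀}⟩` is
unbounded along `n ≥ 1`; the crux fails iff this holds for EVERY `K ≥ 1` (one-arm exponent `< Δσ`). [folklore] -/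
theorem not_oneArmHyperscalingAt_iff (K : ℕ) :
    ¬ OneArmHyperscalingAt K ↔ ∀ C : ℝ, ∃ n : ℕ, 1 ≤ n ∧ C < boxMag (K * n) ^ 2 / axisTwoPoint n := by
  unfold OneArmHyperscalingAt
  push Not
  refine forall_congr' fun C => exists_congr fun n => and_congr_right fun hn => ?_
  rw [lt_div_iff₀ (axisTwoPoint_pos n)]

/-- `¬ crux ↔ ∀ K ≥ 1, the slice-`K` ratio is unbounded`. [folklore] -/
theorem not_oneArmHyperscaling_iff :
    ¬ OneArmHyperscaling ↔
      ∀ K : ℕ, 1 ≤ K → ∀ C : ℝ, ∃ n : ℕ, 1 ≤ n ∧ C < boxMag (K * n) ^ 2 / axisTwoPoint n := by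
  rw [oneArmHyperscaling_iff_at]
  simp only [not_exists, not_and]
  exact forall_congr' fun K => imp_congr_right fun _ => not_oneArmHyperscalingAt_iff K

/-- **The dimension barrier for this crux, mechanised modulo van Engelenburg–Garban–Panis–Severo
(arXiv:2510.23423) Theorem 1.1** (`⟨σ₀⟩⁺_{Λ_n;β_c(d)} ≥ c/n`, every `d ≥ 2`, `n ≥ 1`; not in the tree):
in every dimension `d ≥ 5` the verbatim analogue of the crux is FALSE, because the infrared bound gives
`⟨σ₀σ_{2ne₀}⟩_{β_c(d)} ≤ C₁ n^{-(d-2)} ≤ C₁ n^{-3}` against `(m⁺_{Kn})² ≥ c²/(Kn)²`.  (Their Theorem 1.2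
even gives `m⁺_n ≍ 1/n` for `d > 4`.)  Hence any proof of the crux consumes an input that fails in
`d = 5` — the barrier `IsingTrivialityFromDimensionFour` read for arms; the registered line isolates it
in `stub_faceSaturation`. [cite: VanEngelenburgGarbanPanisSevero2025, Theorem 1.1] -/
theorem oneArmHyperscaling_highDim_false_of_meanFieldLowerBound {d : ℕ} (hd : 5 ≤ d)
    (hLB : ∃ c : ℝ, 0 < c ∧ ∀ n : ℕ, 1 ≤ n →
      c / n ≤ isingCorr (zdGraph d) (box d n) (criticalBeta d) 0 BoundaryCondition.plus
        ({0} : Finset (Site d))) :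
    ¬ ∃ K : ℕ, 1 ≤ K ∧ ∃ C : ℝ, ∀ n : ℕ, 1 ≤ n →
      (isingCorr (zdGraph d) (box d (K * n)) (criticalBeta d) 0 BoundaryCondition.plus
          ({0} : Finset (Site d))) ^ 2 ≤
        C * criticalTwoPoint d (Pi.single (⟨0, by omega⟩ : Fin d) (2 * (n : ℤ))) := by
  rintro ⟨K, hK, C, hC⟩
  obtain ⟨c, hc, hlow⟩ := hLB
  obtain ⟨C₁, hC₁, hIR⟩ := exists_criticalTwoPoint_le_inv_pow (d := d) (by omega)
  have hK0 : (0 : ℝ) < K := by exact_mod_cast hK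
  set i₀ : Fin d := ⟨0, by omega⟩ with hi₀
  -- the two-point function along the axis decays at least like `n^{-3}`
  have hG : ∀ n : ℕ, 1 ≤ n → criticalTwoPoint d (Pi.single i₀ (2 * (n : ℤ))) ≤ C₁ / (n : ℝ) ^ 3 := by
    intro n hn
    have hn0 : (0 : ℝ) < n := by exact_mod_cast hn
    have hne : (Pi.single i₀ (2 * (n : ℤ)) : Site d) ≠ 0 := by
      intro h
      have := congrFun h i₀
      simp at this
      omega
    have h1 := hIR _ hne
    have hsup : Site.supNorm (Pi.single i₀ (2 * (n : ℤ)) : Site d) = 2 * n := by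
      rw [Site.supNorm_single]; omega
    rw [hsup] at h1
    refine h1.trans ?_
    rw [← div_eq_mul_inv]
    apply div_le_div_of_nonneg_left hC₁ (by positivity)
    calc (n : ℝ) ^ 3 ≤ (n : ℝ) ^ (d - 2) := pow_le_pow_right₀ (by exact_mod_cast hn) (by omega)
      _ ≤ ((2 * n : ℕ) : ℝ) ^ (d - 2) := by gcongr; exact_mod_cast (by omega : n ≤ 2 * n)
  -- pick `n` beyond the resulting bound `n ≤ max C 0 * C₁ * K² / c²`
  obtain ⟨n, hn⟩ := exists_nat_gt (max C 0 * C₁ * (K : ℝ) ^ 2 / c ^ 2)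
  have hn1 : 1 ≤ n + 1 := Nat.succ_le_succ (Nat.zero_le n)
  have hn0 : (0 : ℝ) < (n + 1 : ℕ) := by positivity
  have hm := hlow (K * (n + 1)) (Nat.one_le_iff_ne_zero.2 (Nat.mul_ne_zero (by omega) (by omega)))
  have hm2 : (c / ((K * (n + 1) : ℕ) : ℝ)) ^ 2 ≤
      isingCorr (zdGraph d) (box d (K * (n + 1))) (criticalBeta d) 0 BoundaryCondition.plus
        ({0} : Finset (Site d)) ^ 2 := pow_le_pow_left₀ (by positivity) hm 2
  have hGpos : 0 ≤ criticalTwoPoint d (Pi.single i₀ (2 * ((n + 1 : ℕ) : ℤ))) := criticalTwoPoint_nonneg' _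
  have key := hC (n + 1) hn1
  have h1 : (c / ((K * (n + 1) : ℕ) : ℝ)) ^ 2 ≤ max C 0 * (C₁ / ((n + 1 : ℕ) : ℝ) ^ 3) :=
    hm2.trans (key.trans ((mul_le_mul_of_nonneg_right (le_max_left _ _) hGpos).trans
      (mul_le_mul_of_nonneg_left (hG (n + 1) hn1) (le_max_right _ _))))
  -- clear denominators: `c² (n+1) ≤ max C 0 * C₁ * K²`
  have h2 : c ^ 2 * ((n + 1 : ℕ) : ℝ) ≤ max C 0 * C₁ * (K : ℝ) ^ 2 := by
    rw [div_pow, div_le_iff₀ (by positivity)] at h1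
    have h3 : max C 0 * (C₁ / ((n + 1 : ℕ) : ℝ) ^ 3) * (((K * (n + 1) : ℕ) : ℝ)) ^ 2 =
        max C 0 * C₁ * (K : ℝ) ^ 2 / ((n + 1 : ℕ) : ℝ) := by
      push_cast; field_simp
    rw [h3, le_div_iff₀ hn0] at h1
    linarith
  rw [div_lt_iff₀ (by positivity)] at hn
  push_cast at h2 hn
  nlinarith

/-! ### Targets / Line `mirror-face-saturation` (lead reshape of 2026-08-17: stubs SUB, MKV, GEO, SYM, LIM, MCS, SAT)

No payload targets yet (`stuck_stubs = []`).  Paper audit of the registered stubs of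
`Cruxes/OneArmHyperscaling/Lines/mirror_face_saturation.lean` (all quantifier ranges checked, incl. the
degenerate `K = 0, 1`, `n = 0` instances the `∀ K n L` stubs silently include):

* `PlusMagSubmodular` (SUB) — TRUE as typed: it is `f(⋃E) + (m-1)·f(∅) ≤ Σᵢ f(Eᵢ)` for
  `f(E) = ⟨σ_x⟩⁺_{Λ∖E;β,h}`, i.e. decreasing increments of the magnetisation under freezing, which is GHS
  (`∂²⟨σ_x⟩/∂h_u∂h_v ≤ 0`, fields `→ +∞` on the frozen sets); `m = 0, 1` are equalities.  Direction
  sanity-checked by exact enumeration (session script `sub_check.py`: Λ = 3×3×2 ⊂ ℤ³, plus b.c., 140 random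
  instances `β ∈ [0.02, 0.5]`, `h ∈ {0, 0.05, 0.1, 0.2}`, `m ∈ {2,3,4}`: 0 violations, slack up to `2.7e-2`).
* `BoxMagMarkov` (MKV) — TRUE as typed for all `K n L` with `Kn + n + 1 ≤ L` (the six faces are the whole
  exterior vertex boundary of `x_n + Λ_{Kn}`, so the plus measure on `Λ_L ∖ ⋃faces` factorises; `K = 0`
  gives the isolated site with six `+` neighbours on both sides).
* `FaceGeometry` (GEO) — TRUE (linear arithmetic; checked the 15 disjointness pairs by hand, incl. `K = 0`).
* `FaceSymmetry` (SYM) — TRUE for all `K n L i`: each `gᵢ` is a graph automorphism of `ℤ³` fixing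
  `x_n`, with `gᵢ(face i) = facePatch` and `gᵢ(Λ_L) = Λ_L + faceShift n i` (all six recomputed; `Site.shift v`
  is `· + v`, signs of `faceShift` agree).
* `FaceLimit` (LIM) — TRUE: `μ⁺_{Λ}(· | σ_A ≡ +) = μ⁺_{Λ∖A}` in finite volume, GKS monotonicity in `L`,
  denominator limit `≥ 2^{-|A|}`; translated boxes are sandwiched between centred ones.
* `MirrorCauchySchwarz` (MCS) — TRUE: site-plane RP of the critical state, `x_n` and `mirrorPatch`
  strictly inside `{y₀ > 0}` exactly when `K ≥ 2` (`Kn + 1 - n ≥ n + 1`), as required by the stub.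
* `FaceSaturation` (SAT) — the open core; by scaling `F ≍ T/√S ≍ ℓ^{-Δσ}` (`ℓ = Kn`), false for `d > 4`
  like the crux; not attackable by small models (infinite-volume critical state).  No kill.

Joint sufficiency: `faceSubadditivity_of` and `OneArmHyperscaling_of` are sorry-free glue; the line
smuggles no gap (SAT ⊕ MCS-saturation = crux, as the strategist says).
-/

end Summit.CriticalPhenomena.Ising3DConformalLimit.Cruxes.OneArmHyperscaling.Disproof

end
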